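import Mathlib.Data.Nat.Factorization.Induction
import Literature.NumberTheory.DiophantineApproximation.KroneckerTheorem
import Summits.KontsevichZagierPeriods.KontsevichZagierPeriods.Theorems.HurwitzMicroSectorsNormalFormPrincipleDlogMoves

/-!
# `NormalFormPrinciple` (stmt-KontsevichZagierPeriods-3869), line `SketchIdeator1` — stub
# `dlog_sum_mem_relations`, the explicit / elementary route

The registered sub-goal `dlog_sum_mem_relations` of the dlog layer of the leaf `stub_boxRigidity`
(Conjecture 1 in kernel form for the dlog family over `ℚ`), verbatim: a `ℤ`-combination
`Σ nᵢ • [(aᵢ,bᵢ), cᵢ/y]` (`0 < aᵢ < bᵢ`, `aᵢ, bᵢ, cᵢ ∈ ℚ`) of value `0` lies in `KZ.relations`.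

Proof (explicit normal form with **integer** coefficients; the only arithmetic input is unique
factorisation, in the tree form `Kronecker.linearIndependent_log_of_prime`):

1. a common unit `u = 1/D` of the coefficients, `cᵢ = γᵢ u` with `γᵢ ∈ ℤ`, and the merging move
   give `[(a,b), (m u)/y] ≡ m • [(a,b), u/y]` for `m ∈ ℤ` (`dlog_zsmul_sub_mem_relations`);
2. one scaling and one splitting move give `[(aᵢ,bᵢ), u/y] ≡ Λ(Bᵢ) − Λ(Aᵢ)` with the carriers
   `Λ(N) := [(1,N), u/y]` and `bᵢ/aᵢ = Bᵢ/Aᵢ`, `1 ≤ Aᵢ < Bᵢ` naturals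
   (`dlog_sub_carrier_sub_mem_relations`);
3. splitting at `m ∈ [1, pm]` and the dilation `y ↦ m y` give `Λ(pm) ≡ Λ(m) + Λ(p)`, whence
   `Λ(N) ≡ Σ_p v_p(N) • Λ(p)` by induction along the prime factorisation
   (`carrier_sub_factorization_sum_mem_relations`);
4. so `Σ nᵢ • [Lᵢ] ≡ Σ_p M_p • Λ(p)` with `M_p = Σᵢ nᵢ γᵢ (v_p(Bᵢ) − v_p(Aᵢ)) ∈ ℤ`; evaluating,
   `u · Σ_p M_p log p = 0`, hence every `M_p = 0` (the `log p` are `ℤ`-independent) and the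
   right-hand side is literally `0`.

Sources: M. Kontsevich, D. Zagier, *Periods* (2001), §1.1 (`log 2 = ∫₁² dx/x`), §1.2 rules (1), (2).
No definitions are introduced: all representations are quantified through a family `R a b c`
(`= [(a,b), c/y]`) with its domain/integrand description.
-/

noncomputable section

open MeasureTheory Set
open Literature.NumberTheory.Transcendental Literature.NumberTheory.Transcendental.KZ

namespace Summit.KontsevichZagierPeriods.HurwitzMicroSectors.NormalFormPrinciple.PiBox.Dlog

namespace Elementary

/-- **Integer multiples by merging.** On a slab `(a,b)` (`0 < a`), a representation with
integrand `(m u)/y` (`m ∈ ℤ`) is congruent modulo `KZ.relations` to `m • [(a,b), u/y]`: `|m|`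
merging moves (rule 1b) starting from the zero integrand.
[cite: KontsevichZagier2001, §1.2 rule (1)] -/
theorem dlog_zsmul_sub_mem_relations {R : ℚ → ℚ → ℚ → IntegralRep 1}
    (hR : ∀ a b c, 0 < a → (R a b c).domain = {x | x 0 ∈ Set.Ioo (a:ℝ) b} ∧
      (R a b c).integrand = fun x => (c:ℝ) / x 0)
    {a b u : ℚ} (ha : 0 < a) (m : ℤ) (T T₁ : IntegralRep 1)
    (hd : T.domain = {x | x 0 ∈ Set.Ioo (a:ℝ) b}) (hd₁ : T₁.domain = {x | x 0 ∈ Set.Ioo (a:ℝ) b})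
    (hi : EqOn T.integrand (fun x => ((m * u : ℚ) : ℝ) / x 0) T.domain)
    (hi₁ : EqOn T₁.integrand (fun x => (u:ℝ) / x 0) T₁.domain) :
    of T - m • of T₁ ∈ relations := by
  induction m generalizing T with
  | zero =>
    have h0 : EqOn T.integrand (fun x => ((0:ℚ):ℝ) / x 0) T.domain := fun x hx => by
      rw [hi hx]; norm_num
    simpa using dlog_zero_mem_relations T h0
  | succ i ih =>
    obtain ⟨hT'd, hT'i⟩ := hR a b ((i:ℤ) * u) ha
    have hmerge : of T - of (R a b ((i:ℤ) * u)) - of T₁ ∈ relations :=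
      dlog_merge_mem_relations (c := (i:ℤ) * u) (c' := u) T (R a b ((i:ℤ) * u)) T₁ hd hT'd hd₁
        (fun x hx => by rw [hi hx]; push_cast; ring) (fun x _ => by rw [hT'i]) hi₁
    have hT' := ih (R a b ((i:ℤ) * u)) hT'd (fun x _ => by rw [hT'i])
    have e : of T - ((i:ℤ) + 1) • of T₁ =
        (of T - of (R a b ((i:ℤ) * u)) - of T₁) + (of (R a b ((i:ℤ) * u)) - (i:ℤ) • of T₁) := by
      rw [add_smul, one_smul]; abel
    rw [e]
    exact relations.add_mem hmerge hT'
  | pred i ih =>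
    obtain ⟨hT'd, hT'i⟩ := hR a b ((-(i:ℤ) : ℤ) * u) ha
    have hmerge : of (R a b ((-(i:ℤ) : ℤ) * u)) - of T - of T₁ ∈ relations :=
      dlog_merge_mem_relations (c := (-(i:ℤ) - 1 : ℤ) * u) (c' := u) (R a b ((-(i:ℤ) : ℤ) * u))
        T T₁ hT'd hd hd₁ (fun x _ => by rw [hT'i]; push_cast; ring) hi hi₁
    have hT' := ih (R a b ((-(i:ℤ) : ℤ) * u)) hT'd (fun x _ => by rw [hT'i])
    have e : of T - (-(i:ℤ) - 1) • of T₁ =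
        (of (R a b ((-(i:ℤ) : ℤ) * u)) - (-(i:ℤ)) • of T₁)
          - (of (R a b ((-(i:ℤ) : ℤ) * u)) - of T - of T₁) := by
      rw [sub_smul, one_smul, neg_smul]; abel
    rw [e]
    exact relations.sub_mem hT' hmerge

/-- **Integer endpoints.** For rationals `0 < a < b` there are a rational `s > 0` and naturals
`1 ≤ A < B` with `s a = A`, `s b = B`: `A = (b/a).den`, `B = (b/a).num`, `s = A/a`. [folklore] -/
theorem exists_nat_endpoints {a b : ℚ} (ha : 0 < a) (hab : a < b) :
    ∃ (s : ℚ) (A B : ℕ), 0 < s ∧ 1 ≤ A ∧ A < B ∧ s * a = A ∧ s * b = B := by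
  set q : ℚ := b / a with hq
  have hq0 : 0 < q := div_pos (ha.trans hab) ha
  have hnum : 0 ≤ q.num := Rat.num_nonneg.mpr hq0.le
  have hB : ((q.num.toNat : ℕ) : ℚ) = (q.num : ℚ) := by
    rw [← Int.cast_natCast, Int.toNat_of_nonneg hnum]
  have hs : (0:ℚ) < (q.den : ℚ) / a := div_pos (by exact_mod_cast q.den_pos) ha
  have hsa : (q.den : ℚ) / a * a = (q.den : ℕ) := div_mul_cancel₀ _ ha.ne'
  have hsb : (q.den : ℚ) / a * b = (q.num.toNat : ℕ) := by
    rw [hB, div_mul_eq_mul_div, mul_div_assoc, ← hq, Rat.den_mul_eq_num]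
  refine ⟨(q.den : ℚ) / a, q.den, q.num.toNat, hs, q.den_pos, ?_, hsa, hsb⟩
  have hlt : ((q.den : ℕ) : ℚ) < ((q.num.toNat : ℕ) : ℚ) := by
    rw [← hsa, ← hsb]
    exact mul_lt_mul_of_pos_left hab hs
  exact_mod_cast hlt

/-- **A dlog representation is a difference of two carriers.** For rationals `0 < a < b`,
`[(a,b), u/y] ≡ Λ(B) − Λ(A)` modulo `KZ.relations` with `Λ(N) := [(1,N), u/y]` and the naturals
`1 ≤ A < B`, `b/a = B/A` of `exists_nat_endpoints`: one scaling move (rule 2, the dilation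
`y ↦ (A/a) y`) `[(a,b), u/y] ≡ [(A,B), u/y]` and one splitting move (rule 1a at `A ∈ [1,B]`)
`[(1,B), u/y] ≡ [(1,A), u/y] + [(A,B), u/y]`. [cite: KontsevichZagier2001, §1.2 rules (1), (2)] -/
theorem dlog_sub_carrier_sub_mem_relations {R : ℚ → ℚ → ℚ → IntegralRep 1}
    (hR : ∀ a b c, 0 < a → (R a b c).domain = {x | x 0 ∈ Set.Ioo (a:ℝ) b} ∧
      (R a b c).integrand = fun x => (c:ℝ) / x 0)
    (u : ℚ) {a b : ℚ} (ha : 0 < a) (hab : a < b) :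
    ∃ A B : ℕ, 1 ≤ A ∧ A < B ∧ of (R a b u) - (of (R 1 B u) - of (R 1 A u)) ∈ relations := by
  obtain ⟨s, A, B, hs, hA, hAB, hsa, hsb⟩ := exists_nat_endpoints ha hab
  refine ⟨A, B, hA, hAB, ?_⟩
  have hA0 : (0:ℚ) < A := by exact_mod_cast hA
  have hab' := hR a b u ha
  have hAB' := hR A B u hA0
  have h1B := hR 1 B u one_pos
  have h1A := hR 1 A u one_pos
  -- the scaling move `[(a,b), u/y] ≡ [(A,B), u/y]`
  have h1 : of (R a b u) - of (R A B u) ∈ relations :=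
    dlog_scale_mem_relations (s := s) (R a b u) (R A B u) hab'.1 (by rw [hsa, hsb]; exact hAB'.1)
      (fun x _ => by rw [hab'.2]) (fun x _ => by rw [hAB'.2]) ha hs
  -- the splitting move `[(1,B), u/y] ≡ [(1,A), u/y] + [(A,B), u/y]`
  have h2 : of (R 1 B u) - of (R 1 A u) - of (R A B u) ∈ relations :=
    split_mem_relations (R 1 B u) (R 1 A u) (R A B u) h1B.1 h1A.1 hAB'.1 (by exact_mod_cast hA)
      (by exact_mod_cast hAB.le) (fun x _ => by rw [h1A.2, h1B.2]) (fun x _ => by rw [hAB'.2, h1B.2])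
  have e : of (R a b u) - (of (R 1 B u) - of (R 1 A u)) =
      (of (R a b u) - of (R A B u)) - (of (R 1 B u) - of (R 1 A u) - of (R A B u)) := by abel
  rw [e]
  exact relations.sub_mem h1 h2

/-- **Carriers decompose along the prime factorisation.** For the carriers
`Λ(N) := [(1,N), u/y]` (`N ≥ 1`), `Λ(N) ≡ Σ_p v_p(N) • Λ(p)` modulo `KZ.relations`: splitting at
`m ∈ [1, pm]` (rule 1a) and the dilation `y ↦ m y` (rule 2), `Λ(pm) ≡ Λ(m) + [(m,pm), u/y] ≡
Λ(m) + Λ(p)`, by induction along `induction_on_primes`; `Λ(1)` is the empty slab.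
[cite: KontsevichZagier2001, §1.2 rules (1), (2)] -/
theorem carrier_sub_factorization_sum_mem_relations {R : ℚ → ℚ → ℚ → IntegralRep 1}
    (hR : ∀ a b c, 0 < a → (R a b c).domain = {x | x 0 ∈ Set.Ioo (a:ℝ) b} ∧
      (R a b c).integrand = fun x => (c:ℝ) / x 0) (u : ℚ) :
    ∀ N : ℕ, 0 < N →
      of (R 1 N u) - N.factorization.sum (fun p e => (e:ℤ) • of (R 1 p u)) ∈ relations := by
  refine induction_on_primes (fun h => absurd h (lt_irrefl 0)) (fun _ => ?_) ?_
  · rw [Nat.factorization_one, Finsupp.sum_zero_index, sub_zero]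
    exact slab_empty_mem_relations (R 1 ((1:ℕ):ℚ) u) (hR 1 ((1:ℕ):ℚ) u one_pos).1 (by norm_num)
  · intro p m hp ih hpm
    have hm0 : 0 < m := Nat.pos_of_ne_zero (by rintro rfl; simp at hpm)
    have hm0' : (0:ℚ) < m := by exact_mod_cast hm0
    have hcast : ((m:ℚ) * (p:ℚ) : ℚ) = ((p * m : ℕ) : ℚ) := by push_cast; ring
    have hT := hR 1 ((p * m : ℕ) : ℚ) u one_pos
    have hT₁ := hR 1 (m:ℚ) u one_pos
    have hT₂ := hR (m:ℚ) ((p * m : ℕ) : ℚ) u hm0'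
    have hp1 := hR 1 (p:ℚ) u one_pos
    -- the dilation `y ↦ m y`: `[(1,p), u/y] ≡ [(m, pm), u/y]`
    have hscale : of (R 1 (p:ℚ) u) - of (R (m:ℚ) ((p * m : ℕ) : ℚ) u) ∈ relations :=
      dlog_scale_mem_relations (s := (m:ℚ)) (R 1 (p:ℚ) u) (R (m:ℚ) ((p * m : ℕ) : ℚ) u) hp1.1
        (by rw [mul_one, hcast]; exact hT₂.1) (fun x _ => by rw [hp1.2]) (fun x _ => by rw [hT₂.2])
        one_pos hm0'
    -- splitting at `m`: `[(1,pm)] ≡ [(1,m)] + [(m,pm)]`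
    have h1m : ((1:ℚ):ℝ) ≤ ((m:ℚ):ℝ) := by exact_mod_cast Nat.succ_le_of_lt hm0
    have hmpm : ((m:ℚ):ℝ) ≤ (((p * m : ℕ):ℚ):ℝ) := by
      exact_mod_cast Nat.le_mul_of_pos_left m hp.pos
    have hsplit : of (R 1 ((p * m : ℕ) : ℚ) u) - of (R 1 (m:ℚ) u)
        - of (R (m:ℚ) ((p * m : ℕ) : ℚ) u) ∈ relations :=
      split_mem_relations (R 1 ((p * m : ℕ) : ℚ) u) (R 1 (m:ℚ) u) (R (m:ℚ) ((p * m : ℕ) : ℚ) u)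
        hT.1 hT₁.1 hT₂.1 h1m hmpm (fun x _ => by rw [hT₁.2, hT.2]) (fun x _ => by rw [hT₂.2, hT.2])
    have hIH := ih hm0
    -- the factorisation of `p * m`
    have key : (p * m).factorization.sum (fun q e => (e:ℤ) • of (R 1 q u)) =
        of (R 1 (p:ℚ) u) + m.factorization.sum (fun q e => (e:ℤ) • of (R 1 q u)) := by
      rw [Nat.factorization_mul hp.ne_zero hm0.ne', hp.factorization,
        Finsupp.sum_add_index' (fun _ => by simp) (fun _ _ _ => by simp [add_smul]),
        Finsupp.sum_single_index (by simp)]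
      simp
    rw [key]
    have e : of (R 1 ((p * m : ℕ) : ℚ) u)
        - (of (R 1 (p:ℚ) u) + m.factorization.sum (fun q e => (e:ℤ) • of (R 1 q u))) =
        (of (R 1 ((p * m : ℕ) : ℚ) u) - of (R 1 (m:ℚ) u) - of (R (m:ℚ) ((p * m : ℕ) : ℚ) u))
          + (of (R 1 (m:ℚ) u) - m.factorization.sum (fun q e => (e:ℤ) • of (R 1 q u)))
          - (of (R 1 (p:ℚ) u) - of (R (m:ℚ) ((p * m : ℕ) : ℚ) u)) := by
      abel
    rw [e]
    exact relations.sub_mem (relations.add_mem hsplit hIH) hscale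

/-- **Stub `dlog_sum_mem_relations`** (registered sub-goal of crux stmt-KontsevichZagierPeriods-3869,
line `SketchIdeator1`, dlog layer of the leaf `stub_boxRigidity`; explicit / elementary route).
Conjecture 1 of Kontsevich–Zagier in kernel form for the dlog family over `ℚ`: if
`Lᵢ = [(aᵢ,bᵢ), cᵢ/y]` (`0 < aᵢ < bᵢ`, `aᵢ, bᵢ, cᵢ ∈ ℚ`, `nᵢ ∈ ℤ`) and `eval (Σ nᵢ • [Lᵢ]) = 0`, then
`Σ nᵢ • [Lᵢ] ∈ KZ.relations`. The formal combination is moved, by merging, scaling and splitting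
moves only, onto the explicit normal form `Σ_p M_p • [(1,p), u/y]` over the primes `p` with integer
coefficients `M_p`; its value `u Σ_p M_p log p` vanishes, so `M_p = 0` by unique factorisation
(`Kronecker.linearIndependent_log_of_prime`) and the normal form is `0`.
[cite: KontsevichZagier2001, §1.2 Conjecture 1, rules (1), (2)] -/
theorem dlog_sum_mem_relations {k : ℕ} (n : Fin k → ℤ) (a b c : Fin k → ℚ)
    (L : Fin k → IntegralRep 1) (ha : ∀ i, 0 < a i) (hab : ∀ i, a i < b i)
    (hd : ∀ i, (L i).domain = {x | x 0 ∈ Set.Ioo (a i : ℝ) (b i)})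
    (hi : ∀ i, EqOn (L i).integrand (fun x => (c i : ℝ) / x 0) (L i).domain)
    (hv : eval (∑ i, n i • of (L i)) = 0) : ∑ i, n i • of (L i) ∈ relations := by
  classical
  /- the dlog representations `R a b c = [(a,b), c/y]` (`0 < a`) -/
  have hRex : ∀ a b c : ℚ, ∃ T : IntegralRep 1, 0 < a →
      T.domain = {x | x 0 ∈ Set.Ioo (a:ℝ) b} ∧ T.integrand = fun x => (c:ℝ) / x 0 := by
    intro a b c
    by_cases ha : 0 < a
    · obtain ⟨T, hT⟩ := exists_dlog a b c ha
      exact ⟨T, fun _ => hT⟩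
    · obtain ⟨T, -⟩ := exists_dlog 1 1 0 one_pos
      exact ⟨T, fun h => absurd h ha⟩
  choose R hR using hRex
  /- Step 1: a common unit `u` of the coefficients, `c i = γ i * u` with `γ i ∈ ℤ` -/
  obtain ⟨u, hu0, γ, hγ⟩ : ∃ u : ℚ, u ≠ 0 ∧ ∃ γ : Fin k → ℤ, ∀ i, c i = γ i * u := by
    refine ⟨1 / ∏ j, ((c j).den : ℚ), by positivity,
      fun i => (c i).num * ((∏ j ∈ Finset.univ.erase i, (c j).den : ℕ) : ℤ), fun i => ?_⟩
    have hE : (∏ j, ((c j).den : ℚ)) =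
        (∏ j ∈ Finset.univ.erase i, ((c j).den : ℚ)) * (c i).den :=
      (Finset.prod_erase_mul _ _ (Finset.mem_univ i)).symm
    have hden : ((c i).den : ℚ) ≠ 0 := by positivity
    have hEi : (∏ j ∈ Finset.univ.erase i, ((c j).den : ℚ)) ≠ 0 :=
      Finset.prod_ne_zero_iff.mpr fun j _ => by positivity
    push_cast
    rw [hE, mul_one_div, eq_div_iff (mul_ne_zero hEi hden)]
    calc c i * ((∏ j ∈ Finset.univ.erase i, ((c j).den : ℚ)) * (c i).den)
        = (c i * (c i).den) * ∏ j ∈ Finset.univ.erase i, ((c j).den : ℚ) := by ring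
      _ = (c i).num * ∏ j ∈ Finset.univ.erase i, ((c j).den : ℚ) := by rw [Rat.mul_den_eq_num]
  /- Step 2: `[Lᵢ] ≡ γᵢ • [(aᵢ,bᵢ), u/y] ≡ γᵢ • (Λ(Bᵢ) − Λ(Aᵢ))`, `bᵢ/aᵢ = Bᵢ/Aᵢ` -/
  have hABi : ∀ i, ∃ A B : ℕ, 1 ≤ A ∧ A < B ∧
      of (R (a i) (b i) u) - (of (R 1 B u) - of (R 1 A u)) ∈ relations := fun i =>
    dlog_sub_carrier_sub_mem_relations hR u (ha i) (hab i)
  choose A B hA hAB hcar using hABi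
  /- Step 3: the finite set of primes involved and the decomposition of the carriers -/
  set P : Finset ℕ := Finset.univ.biUnion fun i => (A i).primeFactors ∪ (B i).primeFactors
    with hP
  have hPprime : ∀ p ∈ P, p.Prime := by
    intro p hp
    simp only [hP, Finset.mem_biUnion, Finset.mem_univ, true_and, Finset.mem_union] at hp
    obtain ⟨i, h | h⟩ := hp <;> exact Nat.prime_of_mem_primeFactors h
  have hsuppA : ∀ i, (A i).factorization.support ⊆ P := fun i p hp => by
    rw [Nat.support_factorization] at hp
    exact Finset.mem_biUnion.mpr ⟨i, Finset.mem_univ _, Finset.mem_union_left _ hp⟩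
  have hsuppB : ∀ i, (B i).factorization.support ⊆ P := fun i p hp => by
    rw [Nat.support_factorization] at hp
    exact Finset.mem_biUnion.mpr ⟨i, Finset.mem_univ _, Finset.mem_union_right _ hp⟩
  have hG : ∀ N : ℕ, 0 < N → N.factorization.support ⊆ P →
      of (R 1 N u) - ∑ p ∈ P, ((N.factorization p : ℕ) : ℤ) • of (R 1 p u) ∈ relations := by
    intro N hN hsupp
    have h := carrier_sub_factorization_sum_mem_relations hR u N hN
    rwa [Finsupp.sum_of_support_subset _ hsupp _ (fun p _ => by simp)] at h
  -- the exponents `e i p = v_p(Bᵢ) − v_p(Aᵢ)`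
  obtain ⟨e, he⟩ : ∃ e : Fin k → ℕ → ℤ,
      ∀ i p, e i p = (((B i).factorization p : ℕ) : ℤ) - ((A i).factorization p : ℕ) :=
    ⟨_, fun _ _ => rfl⟩
  have hLi : ∀ i, of (L i) - γ i • ∑ p ∈ P, e i p • of (R 1 p u) ∈ relations := by
    intro i
    have h1 : of (L i) - γ i • of (R (a i) (b i) u) ∈ relations :=
      dlog_zsmul_sub_mem_relations hR (ha i) (γ i) (L i) (R (a i) (b i) u) (hd i)
        (hR _ _ _ (ha i)).1 (fun x hx => by rw [hi i hx, hγ i]) (fun x _ => by rw [(hR _ _ _ (ha i)).2])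
    have h3A := hG (A i) (hA i) (hsuppA i)
    have h3B := hG (B i) ((Nat.zero_le _).trans_lt (hAB i)) (hsuppB i)
    have h4 : of (R (a i) (b i) u) - ∑ p ∈ P, e i p • of (R 1 p u) ∈ relations := by
      have e4 : of (R (a i) (b i) u) - ∑ p ∈ P, e i p • of (R 1 p u) =
          (of (R (a i) (b i) u) - (of (R 1 (B i) u) - of (R 1 (A i) u)))
            + (of (R 1 (B i) u) - ∑ p ∈ P, (((B i).factorization p : ℕ) : ℤ) • of (R 1 p u))
            - (of (R 1 (A i) u) - ∑ p ∈ P, (((A i).factorization p : ℕ) : ℤ) • of (R 1 p u)) := by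
        simp only [he, sub_smul, Finset.sum_sub_distrib]
        abel
      rw [e4]
      exact relations.sub_mem (relations.add_mem (hcar i) h3B) h3A
    have e1 : of (L i) - γ i • ∑ p ∈ P, e i p • of (R 1 p u) =
        (of (L i) - γ i • of (R (a i) (b i) u))
          + γ i • (of (R (a i) (b i) u) - ∑ p ∈ P, e i p • of (R 1 p u)) := by
      rw [smul_sub]; abel
    rw [e1]
    exact relations.add_mem h1 (relations.zsmul_mem h4 _)
  /- Step 4: the normal form `Σ_p M_p • Λ(p)` with integer coefficients -/
  obtain ⟨M, hM⟩ : ∃ M : ℕ → ℤ, ∀ p, M p = ∑ i, n i * (γ i * e i p) := ⟨_, fun _ => rfl⟩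
  have hsum : ∑ i, n i • of (L i) - ∑ p ∈ P, M p • of (R 1 p u) ∈ relations := by
    have h1 : ∑ i, n i • of (L i) - ∑ i, n i • (γ i • ∑ p ∈ P, e i p • of (R 1 p u))
        ∈ relations := by
      rw [← Finset.sum_sub_distrib]
      exact sum_mem fun i _ => by rw [← smul_sub]; exact relations.zsmul_mem (hLi i) _
    have h2 : ∑ i, n i • (γ i • ∑ p ∈ P, e i p • of (R 1 p u)) =
        ∑ p ∈ P, M p • of (R 1 p u) := by
      simp only [Finset.smul_sum, smul_smul, hM, Finset.sum_smul]
      rw [Finset.sum_comm]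
    rwa [h2] at h1
  /- Step 5: the value of the normal form is `u Σ_p M_p log p = 0` -/
  have hval : ∀ p ∈ P, (R 1 p u).value = (u:ℝ) * Real.log p := fun p hp => by
    have h1p : (1:ℚ) ≤ (p:ℚ) := by exact_mod_cast (hPprime p hp).one_lt.le
    rw [value_dlog (R 1 (p:ℚ) u) (hR 1 (p:ℚ) u one_pos).1
      (fun x _ => by rw [(hR 1 (p:ℚ) u one_pos).2]) one_pos h1p]
    simp
  have hlog : ∑ p ∈ P, (M p : ℝ) * Real.log p = 0 := by
    have hker := relations_le_ker_eval_holds hsum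
    rw [AddMonoidHom.mem_ker, map_sub, hv, zero_sub, neg_eq_zero, map_sum] at hker
    have h1 : ∑ p ∈ P, (M p : ℝ) * ((u:ℝ) * Real.log p) = 0 := by
      rw [← hker]
      refine Finset.sum_congr rfl fun p hp => ?_
      rw [map_zsmul, eval_of, hval p hp, zsmul_eq_mul]
    have hu : (u:ℝ) ≠ 0 := by exact_mod_cast hu0
    have h2 : (u:ℝ) * ∑ p ∈ P, (M p : ℝ) * Real.log p = 0 := by
      rw [Finset.mul_sum, ← h1]
      exact Finset.sum_congr rfl fun p _ => by ring
    exact (mul_eq_zero.mp h2).resolve_left hu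
  /- Step 6: unique factorisation — all `M_p` vanish, so the normal form is `0` -/
  have hM0 : ∀ p ∈ P, M p = 0 := by
    have hZ := Literature.NumberTheory.DiophantineApproximation.Kronecker.linearIndependent_log_of_prime
      P hPprime
    rw [Fintype.linearIndependent_iff] at hZ
    have h := hZ (fun p => M p) (by
      have h0 := hlog
      rw [← Finset.sum_coe_sort P] at h0
      simpa [zsmul_eq_mul] using h0)
    exact fun p hp => h ⟨p, hp⟩
  have hzero : ∑ p ∈ P, M p • of (R 1 p u) = 0 :=
    Finset.sum_eq_zero fun p hp => by rw [hM0 p hp, zero_smul]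
  rw [hzero, sub_zero] at hsum
  exact hsum

end Elementary

end Summit.KontsevichZagierPeriods.HurwitzMicroSectors.NormalFormPrinciple.PiBox.Dlog
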